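import Mathlib.ModelTheory.Definability
import Mathlib.ModelTheory.ElementaryMaps
import HarnessLib

/-!
# Definitional expansions are conservative: translating away defined symbols

Topic `Literature/ModelTheory/ExponentialFields` (general model theory used by the restricted
exponential / `e(x) = exp((1 + x²)⁻¹)` reducts of the models of `T_exp`, Wilkie 1996, §9;
den Besten 2016, Definition 6.2.2, Lemma 6.2.3).

Let `L` be a first-order language and `L₂` a second language of *new* symbols.  Suppose an
`L.sum L₂`-structure `M` (an `L`-structure together with an `L₂`-structure on the same carrier)
interprets every new function symbol `g` by a function whose graph is defined by a fixed
`L`-formula `δ g`, and every new relation symbol `R` by the set defined by a fixed `L`-formula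
`ρ R` ("`M` is a definitional expansion of `M|L` along `D = (δ, ρ)`", `Definitions.IsDefinedBy`).
Then every `L.sum L₂`-formula is equivalent in `M` to an `L`-formula obtained by an explicit,
structure-independent translation (unnesting of terms: Hodges, *Model Theory* (1993), §2.6,
Theorem 2.6.4, "definitional expansions"; Marker 2002, Exercise 1.4.14):

* `Definitions.termGraph D t` — the `L`-formula "`u = t`" for an `L.sum L₂`-term `t`
  (`realize_termGraph`);
* `Definitions.translate D φ` — the `L`-formula equivalent to the bounded `L.sum L₂`-formula `φ`
  (`realize_translate`), and `Definitions.translateSentence` (`realize_translateSentence`).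

Consequences (all proved, no named facts):

* `Definitions.IsDefinedBy.definable_of_definable_sum`: sets definable (with parameters) in the
  expansion are definable in `L` with the same parameters;
* `Definitions.IsDefinedBy.models_completeTheory_sum`: if `M ⊨ Th_L(N)` and `M`, `N` are
  definitional expansions along the same `D`, then `M ⊨ Th_{L.sum L₂}(N)` — expansions by
  definable functions and relations of elementarily equivalent structures are elementarily
  equivalent (`elementarilyEquivalent_sum`);
* `Definitions.IsDefinedBy.elementaryEmbeddingSum`: an `L`-elementary embedding between two
  definitional expansions along the same `D` is an `L.sum L₂`-elementary embedding.

These are the facts by which a model `K` of `T_exp = Th(ℝ; +, ·, -, 0, 1, exp, ≤)` becomes a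
model of `T_e = Th(ℝ; +, ·, -, 0, 1, e, ≤)` on interpreting `e` by `exp((1 + x²)⁻¹)`
(den Besten 2016, Definition 6.2.2), and `Th(ℝ; exp↾[0,1])`, etc.

## Design

The translation lands in `L.Formula (β ⊕ Fin n)` (all bound variables of a
`BoundedFormula β n` opened up as named variables) and quantifies with Mathlib's
`Formula.iExs` / `Formula.iAlls` over finite variable types, so that no de Bruijn arithmetic
(`liftAt`, `castLE`) is needed.  Defining formulas follow Mathlib's `Formula.graph` convention:
`δ g : L.Formula (Fin (k + 1))` is realized at `Fin.cons y x̄` for "`g(x̄) = y`".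

## References

* W. Hodges, *Model Theory*, Encyclopedia Math. Appl. 42, CUP 1993, §2.6 (definitional
  expansions, Theorem 2.6.4). [Hodges1993]
* D. Marker, *Model Theory: An Introduction*, GTM 217, Springer 2002, §1.4. [Marker2002]
* M. den Besten, *Wilkie's Theorem and the Uniform Real Schanuel Conjecture*, MSc thesis,
  Utrecht 2016, Definition 6.2.2, Lemma 6.2.3. [DenBesten2016]
-/

open FirstOrder FirstOrder.Language FirstOrder.Language.Structure
open scoped FirstOrder

namespace Literature.ModelTheory.ExponentialFields

universe u v u' v' w w'

/-- **Defining formulas** for the symbols of a language `L₂` in a language `L`: for each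
function symbol `g` of arity `k` an `L`-formula `δ g` in the variables `Fin (k + 1)` (value
first, then the arguments, as in Mathlib's `Formula.graph`), and for each relation symbol `R` of
arity `k` an `L`-formula `ρ R` in the variables `Fin k` (Hodges 1993, §2.6: explicit
definitions of the new symbols). [cite: Hodges1993, §2.6] -/
structure Definitions (L : Language.{u, v}) (L₂ : Language.{u', v'}) where
  /-- the formula defining the graph of the new function symbol `g`: `δ g (y, x̄)` iff `g x̄ = y` -/
  δ : ∀ {k : ℕ}, L₂.Functions k → L.Formula (Fin (k + 1))
  /-- the formula defining the new relation symbol `R` -/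
  ρ : ∀ {k : ℕ}, L₂.Relations k → L.Formula (Fin k)

namespace Definitions

variable {L : Language.{u, v}} {L₂ : Language.{u', v'}}

/-- An `L`-structure carrying also an `L₂`-structure **is defined by** `D` if each new function
symbol `g` is interpreted by the function whose graph `δ g` defines and each new relation symbol
`R` by the set `ρ R` defines: `M` as an `L.sum L₂`-structure is a *definitional expansion* of
`M|L` (Hodges 1993, §2.6). [cite: Hodges1993, §2.6] -/
structure IsDefinedBy (D : Definitions L L₂) (M : Type w) [L.Structure M] [L₂.Structure M] :
    Prop where
  /-- `δ g` defines the graph of `g` -/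
  realize_δ_iff : ∀ {k : ℕ} (g : L₂.Functions k) (x : Fin k → M) (y : M),
    (D.δ g).Realize (Fin.cons y x) ↔ funMap g x = y
  /-- `ρ R` defines `R` -/
  realize_ρ_iff : ∀ {k : ℕ} (R : L₂.Relations k) (x : Fin k → M),
    (D.ρ R).Realize x ↔ RelMap R x

/-! ### Variable bookkeeping -/

/-- Relabelling used to plug the value variable of the `i`-th argument into the `i`-th fresh
variable, keeping a value slot. [folklore] -/
def argIdx (γ : Type w') (l : ℕ) (i : Fin l) : γ ⊕ Unit → (γ ⊕ Unit) ⊕ Fin l :=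
  Sum.elim (fun x => Sum.inl (Sum.inl x)) fun _ => Sum.inr i

/-- Relabelling used to plug the value variable of the `i`-th argument into the `i`-th fresh
variable, without a value slot. [folklore] -/
def argIdx' (γ : Type w') (l : ℕ) (i : Fin l) : γ ⊕ Unit → γ ⊕ Fin l :=
  Sum.elim Sum.inl fun _ => Sum.inr i

/-- Relabelling of a defining formula `δ g`: value slot `0 ↦ u`, argument `i.succ ↦` the
`i`-th fresh variable. [folklore] -/
def valIdx (γ : Type w') (l : ℕ) : Fin (l + 1) → (γ ⊕ Unit) ⊕ Fin l :=
  Fin.cons (Sum.inl (Sum.inr ())) fun i => Sum.inr i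

/-- Relabelling opening the last bound variable as the `Unit` variable. [folklore] -/
def snocIdx (β : Type w') (n : ℕ) : β ⊕ Fin (n + 1) → (β ⊕ Fin n) ⊕ Unit :=
  Sum.elim (fun b => Sum.inl (Sum.inl b))
    (Fin.lastCases (Sum.inr ()) fun i => Sum.inl (Sum.inr i))

section Bookkeeping

variable {M : Type w} {γ β : Type w'}

/-- Evaluation after `argIdx`. [folklore] -/
theorem comp_argIdx {l : ℕ} (v : γ → M) (c : Unit → M) (w : Fin l → M) (i : Fin l) :
    Sum.elim (Sum.elim v c) w ∘ argIdx γ l i = Sum.elim v fun _ => w i := by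
  funext x
  rcases x with x | ⟨⟩ <;> rfl

/-- Evaluation after `argIdx'`. [folklore] -/
theorem comp_argIdx' {l : ℕ} (v : γ → M) (w : Fin l → M) (i : Fin l) :
    Sum.elim v w ∘ argIdx' γ l i = Sum.elim v fun _ => w i := by
  funext x
  rcases x with x | ⟨⟩ <;> rfl

/-- Evaluation after `valIdx`. [folklore] -/
theorem comp_valIdx {l : ℕ} (v : γ → M) (u : M) (w : Fin l → M) :
    Sum.elim (Sum.elim v fun _ => u) w ∘ valIdx γ l = Fin.cons u w := by
  funext j
  refine Fin.cases ?_ (fun i => ?_) j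
  · simp [valIdx]
  · simp [valIdx]

/-- Evaluation after `snocIdx`. [folklore] -/
theorem comp_snocIdx {n : ℕ} (v : β → M) (xs : Fin n → M) (c : Unit → M) :
    Sum.elim (Sum.elim v xs) c ∘ snocIdx β n = Sum.elim v (Fin.snoc xs (c ())) := by
  funext x
  rcases x with b | j
  · rfl
  · simp only [snocIdx, Function.comp_apply, Sum.elim_inr]
    refine Fin.lastCases ?_ (fun i => ?_) j
    · simp
    · simp

end Bookkeeping

/-! ### Unnesting terms -/

/-- **"`u = t`" as an `L`-formula.**  For an `L.sum L₂`-term `t` in variables `γ`, the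
`L`-formula `termGraph D t` in variables `γ ⊕ Unit` (the extra variable for the value of `t`):
`f(t₁, …, t_l)` becomes `∃ w₁ … w_l, ⋀ᵢ "wᵢ = tᵢ" ∧ u = f(w̄)` for an old symbol `f` and
`∃ w̄, ⋀ᵢ "wᵢ = tᵢ" ∧ δ g (u, w̄)` for a new symbol `g` (Hodges 1993, §2.6, unnesting).
[cite: Hodges1993, §2.6] -/
noncomputable def termGraph (D : Definitions L L₂) {γ : Type w'} :
    (L.sum L₂).Term γ → L.Formula (γ ⊕ Unit)
  | var x => Term.equal (var (Sum.inr ())) (var (Sum.inl x))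
  | @Term.func _ _ l (Sum.inl f) ts =>
      Formula.iExs (Fin l)
        ((Formula.iInf fun i => (termGraph D (ts i)).relabel (argIdx γ l i)) ⊓
          Term.equal (var (Sum.inl (Sum.inr ()))) (func f fun i => var (Sum.inr i)))
  | @Term.func _ _ l (Sum.inr g) ts =>
      Formula.iExs (Fin l)
        ((Formula.iInf fun i => (termGraph D (ts i)).relabel (argIdx γ l i)) ⊓
          (D.δ g).relabel (valIdx γ l))

variable {D : Definitions L L₂} {M : Type w} [L.Structure M] [L₂.Structure M]

/-- **Correctness of unnesting**: in a structure defined by `D`, `termGraph D t` holds at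
`(v, u)` iff `u` is the value of `t` at `v` (Hodges 1993, §2.6). [cite: Hodges1993, §2.6] -/
theorem realize_termGraph (hM : D.IsDefinedBy M) {γ : Type w'} (t : (L.sum L₂).Term γ)
    (v : γ → M) (u : M) :
    (termGraph D t).Realize (Sum.elim v fun _ => u) ↔ u = t.realize v := by
  induction t generalizing u with
  | var x => simp [termGraph]
  | func f ts ih =>
    cases f with
    | inl f =>
      simp only [termGraph, Formula.realize_iExs, Formula.realize_inf, Formula.realize_iInf,
        Formula.realize_relabel, comp_argIdx, ih, Formula.realize_equal, Term.realize_var,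
        Sum.elim_inl, Sum.elim_inr, Term.realize_func, funMap_sumInl]
      constructor
      · rintro ⟨w, hw, rfl⟩
        congr 1
        funext i
        simpa using hw i
      · rintro rfl
        exact ⟨fun i => (ts i).realize v, fun i => rfl, rfl⟩
    | inr g =>
      simp only [termGraph, Formula.realize_iExs, Formula.realize_inf, Formula.realize_iInf,
        Formula.realize_relabel, comp_argIdx, ih, comp_valIdx, hM.realize_δ_iff,
        Term.realize_func, funMap_sumInr]
      constructor
      · rintro ⟨w, hw, rfl⟩
        congr 1
        funext i
        exact hw i
      · rintro rfl
        exact ⟨fun i => (ts i).realize v, fun i => rfl, rfl⟩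

/-! ### Translating formulas -/

/-- **The translation** of a bounded `L.sum L₂`-formula into an `L`-formula (bound variables
opened as named variables `Fin n`): atomic formulas are unnested through `termGraph`, new
relation symbols replaced by their definitions, connectives and quantifiers kept
(Hodges 1993, Theorem 2.6.4). [cite: Hodges1993, Thm 2.6.4] -/
noncomputable def translate (D : Definitions L L₂) {β : Type w'} :
    ∀ {n : ℕ}, (L.sum L₂).BoundedFormula β n → L.Formula (β ⊕ Fin n)
  | _, BoundedFormula.falsum => ⊥
  | _, BoundedFormula.equal t₁ t₂ => Formula.iExs Unit (termGraph D t₁ ⊓ termGraph D t₂)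
  | n, @BoundedFormula.rel _ _ _ l (Sum.inl R) ts =>
      Formula.iExs (Fin l)
        ((Formula.iInf fun i => (termGraph D (ts i)).relabel (argIdx' (β ⊕ Fin n) l i)) ⊓
          R.formula fun i => var (Sum.inr i))
  | n, @BoundedFormula.rel _ _ _ l (Sum.inr R) ts =>
      Formula.iExs (Fin l)
        ((Formula.iInf fun i => (termGraph D (ts i)).relabel (argIdx' (β ⊕ Fin n) l i)) ⊓
          (D.ρ R).relabel Sum.inr)
  | _, BoundedFormula.imp φ ψ => (translate D φ).imp (translate D ψ)
  | n, BoundedFormula.all φ => Formula.iAlls Unit ((translate D φ).relabel (snocIdx β n))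

/-- **Correctness of the translation** (Hodges 1993, Theorem 2.6.4): in a structure defined by
`D`, a bounded `L.sum L₂`-formula and its translation agree at every valuation.
[cite: Hodges1993, Thm 2.6.4] -/
theorem realize_translate (hM : D.IsDefinedBy M) {β : Type w'} :
    ∀ {n : ℕ} (φ : (L.sum L₂).BoundedFormula β n) (v : β → M) (xs : Fin n → M),
      (translate D φ).Realize (Sum.elim v xs) ↔ φ.Realize v xs := by
  intro n φ
  induction φ with
  | falsum => intro v xs; simp [translate, BoundedFormula.Realize]
  | equal t₁ t₂ =>
    intro v xs
    simp only [translate, Formula.realize_iExs, Formula.realize_inf, BoundedFormula.Realize]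
    constructor
    · rintro ⟨c, h₁, h₂⟩
      have e : (Sum.elim (Sum.elim v xs) c) = Sum.elim (Sum.elim v xs) (fun _ => c ()) := by
        funext x; rcases x with x | ⟨⟩ <;> rfl
      rw [e, realize_termGraph hM] at h₁ h₂
      exact h₁.symm.trans h₂
    · intro h
      refine ⟨fun _ => t₁.realize (Sum.elim v xs), ?_, ?_⟩
      · exact (realize_termGraph hM t₁ _ _).2 rfl
      · exact (realize_termGraph hM t₂ _ _).2 h
  | rel R ts =>
    intro v xs
    cases R with
    | inl R =>
      simp only [translate, Formula.realize_iExs, Formula.realize_inf, Formula.realize_iInf,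
        Formula.realize_relabel, comp_argIdx', realize_termGraph hM, Formula.realize_rel,
        Term.realize_var, Sum.elim_inr, BoundedFormula.Realize, relMap_sumInl]
      constructor
      · rintro ⟨w, hw, h⟩
        have : w = fun i => (ts i).realize (Sum.elim v xs) := funext hw
        subst this
        exact h
      · intro h
        exact ⟨fun i => (ts i).realize (Sum.elim v xs), fun i => rfl, h⟩
    | inr R =>
      simp only [translate, Formula.realize_iExs, Formula.realize_inf, Formula.realize_iInf,
        Formula.realize_relabel, comp_argIdx', realize_termGraph hM, Sum.elim_comp_inr,
        hM.realize_ρ_iff, BoundedFormula.Realize, relMap_sumInr]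
      constructor
      · rintro ⟨w, hw, h⟩
        have : w = fun i => (ts i).realize (Sum.elim v xs) := funext hw
        subst this
        exact h
      · intro h
        exact ⟨fun i => (ts i).realize (Sum.elim v xs), fun i => rfl, h⟩
  | imp φ ψ ihφ ihψ =>
    intro v xs
    simp only [translate, Formula.realize_imp, ihφ, ihψ, BoundedFormula.realize_imp]
  | all φ ih =>
    intro v xs
    simp only [translate, Formula.realize_iAlls, Formula.realize_relabel,
      BoundedFormula.realize_all]
    constructor
    · intro h a
      have h' := h fun _ => a
      have e : (fun x => Sum.elim (Sum.elim v xs) (fun _ : Unit => a) x) ∘ snocIdx β _ =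
          Sum.elim v (Fin.snoc xs a) := comp_snocIdx v xs fun _ => a
      rw [e, ih] at h'
      exact h'
    · intro h c
      have e : (fun x => Sum.elim (Sum.elim v xs) c x) ∘ snocIdx β _ =
          Sum.elim v (Fin.snoc xs (c ())) := comp_snocIdx v xs c
      rw [e, ih]
      exact h (c ())

/-- The translation of a formula (no bound variables), as a formula in the same variables.
[folklore] -/
noncomputable def translateFormula (D : Definitions L L₂) {β : Type w'}
    (φ : (L.sum L₂).Formula β) : L.Formula β :=
  (translate D φ).relabel (Sum.elim id Fin.elim0)

/-- Correctness of `translateFormula`. [folklore] -/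
theorem realize_translateFormula (hM : D.IsDefinedBy M) {β : Type w'}
    (φ : (L.sum L₂).Formula β) (v : β → M) :
    (translateFormula D φ).Realize v ↔ φ.Realize v := by
  rw [translateFormula, Formula.realize_relabel]
  have e : v ∘ Sum.elim id Fin.elim0 = Sum.elim v (default : Fin 0 → M) := by
    funext x; rcases x with x | i
    · rfl
    · exact i.elim0
  rw [e, realize_translate hM]
  rfl

/-- The translation of a sentence, as a sentence. [folklore] -/
noncomputable def translateSentence (D : Definitions L L₂) (σ : (L.sum L₂).Sentence) :
    L.Sentence :=
  translateFormula D σ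

/-- Correctness of `translateSentence`: `M ⊨ σ` iff `M ⊨ translateSentence D σ`. [folklore] -/
theorem realize_translateSentence (hM : D.IsDefinedBy M) (σ : (L.sum L₂).Sentence) :
    M ⊨ translateSentence D σ ↔ M ⊨ σ :=
  realize_translateFormula hM σ default

/-! ### Consequences -/

namespace IsDefinedBy

/-- **Definable sets of a definitional expansion are definable in the base language**, with the
same parameters (Hodges 1993, Theorem 2.6.4). [cite: Hodges1993, Thm 2.6.4] -/
theorem definable_of_definable_sum (hM : D.IsDefinedBy M) {A : Set M} {α : Type*}
    {s : Set (α → M)} (hs : A.Definable (L.sum L₂) s) : A.Definable L s := by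
  rw [Set.definable_iff_exists_formula_sum] at hs ⊢
  obtain ⟨φ, rfl⟩ := hs
  refine ⟨translateFormula D φ, ?_⟩
  ext v
  simp only [Set.mem_setOf_eq, realize_translateFormula hM]

/-- Conversely (trivially) `L`-definable sets are definable in the expansion. [folklore] -/
theorem definable_sum_of_definable {A : Set M} {α : Type*} {s : Set (α → M)}
    (hs : A.Definable L s) : A.Definable (L.sum L₂) s :=
  hs.map_expansion LHom.sumInl

/-- Definability in a definitional expansion is definability in the base language. [folklore] -/
theorem definable_sum_iff (hM : D.IsDefinedBy M) {A : Set M} {α : Type*} {s : Set (α → M)} :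
    A.Definable (L.sum L₂) s ↔ A.Definable L s :=
  ⟨hM.definable_of_definable_sum, definable_sum_of_definable⟩

variable {N : Type w} [L.Structure N] [L₂.Structure N]

/-- **Definitional expansions of elementarily equivalent structures are elementarily
equivalent**: if `M ⊨ Th_L(N)` and both `M`, `N` are defined by the same `D`, then
`M ⊨ Th_{L.sum L₂}(N)` (Hodges 1993, §2.6). [cite: Hodges1993, §2.6] -/
theorem models_completeTheory_sum (hM : D.IsDefinedBy M) (hN : D.IsDefinedBy N)
    (h : M ⊨ L.completeTheory N) : M ⊨ (L.sum L₂).completeTheory N := by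
  refine ⟨fun σ hσ => ?_⟩
  have hN' : N ⊨ translateSentence D σ :=
    (realize_translateSentence hN σ).2 (mem_completeTheory.1 hσ)
  have hM' : M ⊨ translateSentence D σ :=
    h.realize_of_mem _ (mem_completeTheory.2 hN')
  exact (realize_translateSentence hM σ).1 hM'

/-- Elementary equivalence in `L` of two structures defined by `D` implies elementary
equivalence in `L.sum L₂` (Hodges 1993, §2.6). [cite: Hodges1993, §2.6] -/
theorem elementarilyEquivalent_sum (hM : D.IsDefinedBy M) (hN : D.IsDefinedBy N)
    (h : L.ElementarilyEquivalent M N) : (L.sum L₂).ElementarilyEquivalent M N := by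
  ext σ
  rw [mem_completeTheory, mem_completeTheory, ← realize_translateSentence hM,
    ← realize_translateSentence hN, ← mem_completeTheory, ← mem_completeTheory]
  exact Set.ext_iff.1 h _

/-- **An `L`-elementary embedding between two structures defined by the same `D` is an
`L.sum L₂`-elementary embedding** (in particular it commutes with the new symbols)
(Hodges 1993, §2.6). [cite: Hodges1993, §2.6] -/
noncomputable def elementaryEmbeddingSum (hM : D.IsDefinedBy M) (hN : D.IsDefinedBy N)
    (f : M ↪ₑ[L] N) : M ↪ₑ[L.sum L₂] N where
  toFun := f
  map_formula' := by
    intro n φ x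
    rw [← realize_translateFormula hN, ← realize_translateFormula hM]
    exact f.map_formula _ x

/-- The underlying map of `elementaryEmbeddingSum` is that of `f`. [folklore] -/
@[simp]
theorem elementaryEmbeddingSum_apply (hM : D.IsDefinedBy M) (hN : D.IsDefinedBy N)
    (f : M ↪ₑ[L] N) (x : M) : hM.elementaryEmbeddingSum hN f x = f x :=
  rfl

end IsDefinedBy

end Definitions

end Literature.ModelTheory.ExponentialFields
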